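import Summits.QuantumFields.YangMills.Theorems.FemtoCutoffLadderDyadicTelescoping
import Summits.QuantumFields.YangMills.Theorems.FemtoCutoffLadderWindowMatching

/-!
# Femto transfer gap — the UPPER dyadic telescoping: one-octave steps «fine below coarse» with a summable defect telescope to the
# `k`-uniform dyadic nested upper comparison (variational direction of crux `SubOctaveBounded`, child `DyadicNestedUpper`
# stmt-QuantumFields-25766 of route `FemtoCutoffLadder`)

Lead seat `ym-line-fcl-p1` g9 (2026-08-28).  Route-independent (imports no `Theses` file; hypotheses spelled out).  The child
`DyadicNestedUpper` asks, uniformly in the height `k` and the base `L' ≥ L₀`, `z(Λ, 2^k·L') ≤ z(Λ, L') + CΛ²` — in cross-multiplied form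
`λ₁(L')^{L'}·λ₀(L)^L ≤ e^{CΛ²}·λ₁(L)^L·λ₀(L')^{L'}`, `L = 2^k L'`, at matched running parameter.  Proved directly through ONE trial function
pulled back along the `2^k`-fold block map, the `k`-uniformity is lattice-`L'`-versus-near-continuum control (every scale between `1/(2^k L')`
and `1/L'` integrated out at once).  The RG-natural alternative is ONE OCTAVE AT A TIME: the mirror image of `OctaveStepDecay` in the upper
(variational) direction, for every base `L' ≥ L₀`,

  (U₈)  `λ₁(L')^{L'}·λ₀(2L')^{2L'} ≤ exp(CΛ²/L'^σ + D(1/β' − 1/β))·λ₁(2L')^{2L'}·λ₀(L')^{L'}`   (matched `(β, 2L')`, `(β', L')`; `σ > 0`, `D ≥ 0`),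

whose Symanzik-type defect `CΛ²/L'^σ` is SUMMABLE up the tower and whose asymptotic-scaling allowance TELESCOPES (`β` increases up the
tower, `WindowMatching.beta_lt_of_matched`).  This module proves the telescoping:
* ★★ `upper_dyadic_chain` — (U₈) + deep-window matching ⟹ for all `k`, `L' ≥ L₀`, `L = 2^k L'`:
  `λ₁(L')^{L'}·λ₀(L)^L ≤ exp((Φ(L) − Φ(L'))Λ² + D(1/β' − 1/β))·λ₁(L)^L·λ₀(L')^{L'}` with the potential `Φ(m) = (C⁺/κ)(1 − m^{−σ})`,
  `κ = 1 − 2^{−σ}` (induction on `k` through the height-`k` matched coupling; the `k = 0` member is the uniqueness of the matched coupling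
  at one size, `WindowMatching.beta_eq_of_window`);
* ★★ `dyadicNestedUpper_text_of_octaveUpper` — hence the body of `DyadicNestedUpper` with `C_DNU = C⁺/κ + D` (`1/β' ≤ Λ³/2 ≤ Λ²` deep in
  the window), even with the extra decay `C⁺/(κ L'^σ)` in the base.
So a prover of 25766 may prove the ONE-OCTAVE upper step with decay (same kind of statement as `OctaveStepDecay`, opposite = variational
direction, any base) instead of a `k`-uniform multi-octave comparison.  The by-name closer is `FemtoCutoffLadderDyadicNestedUpperOfOctave`.
HONEST FRAMING: bookkeeping (real arithmetic over the tree's positivity lemmas); (U₈) is OPEN and sits behind `UVStabilityNonUniqueness`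
exactly like `OctaveStepDecay`.  R2b1 is a RECORD rung — not infinite volume, not a mass gap, not Clay; no summit is proved by this line.
No definitions, no named facts, no `sorry`.
References: K. Symanzik, Nucl. Phys. B226 (1983) 187 (size `a^σ` of one-step artefacts) [cite: Symanzik1983]; M. Lüscher, P. Weisz,
U. Wolff, Nucl. Phys. B359 (1991) 221 (step scaling at matched coupling) [cite: LuscherWeiszWolff1991].
-/

set_option autoImplicit false

noncomputable section

namespace Summit.QuantumFields.YangMills.Theorems.FemtoTransferGap.CutoffLadder

open Real
open Summit.QuantumFields.YangMills.Theorems.FemtoTransferGap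
open Summit.QuantumFields.YangMills.Theorems.FemtoCutoffLadder

/-- Chaining two cross-multiplied comparisons through a common middle lattice: from `S'·T_M ≤ e^{E}·S_M·T'` (coarse vs middle) and
`S_M·T_L ≤ e^{e}·S_L·T_M` (middle vs fine) with `T_M > 0`, `T', T_L ≥ 0`, get `S'·T_L ≤ e^{E+e}·S_L·T'`. [folklore] -/
theorem upper_chain_mul {S' T' SM TM SL TL E e : ℝ} (hTM : 0 < TM) (hT' : 0 ≤ T') (hTL : 0 ≤ TL)
    (h1 : S' * TM ≤ Real.exp E * (SM * T')) (h2 : SM * TL ≤ Real.exp e * (SL * TM)) :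
    S' * TL ≤ Real.exp (E + e) * (SL * T') := by
  have h3 : S' * TM * TL ≤ Real.exp E * T' * (SM * TL) := by
    have := mul_le_mul_of_nonneg_right h1 hTL
    calc S' * TM * TL ≤ Real.exp E * (SM * T') * TL := this
      _ = Real.exp E * T' * (SM * TL) := by ring
  have h4 : Real.exp E * T' * (SM * TL) ≤ Real.exp E * T' * (Real.exp e * (SL * TM)) :=
    mul_le_mul_of_nonneg_left h2 (mul_nonneg (Real.exp_pos E).le hT')
  have h5 : (S' * TL) * TM ≤ (Real.exp (E + e) * (SL * T')) * TM := by
    calc (S' * TL) * TM = S' * TM * TL := by ring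
      _ ≤ Real.exp E * T' * (Real.exp e * (SL * TM)) := h3.trans h4
      _ = (Real.exp (E + e) * (SL * T')) * TM := by rw [Real.exp_add]; ring
  exact le_of_mul_le_mul_right h5 hTM

/-- ★★ **The upper dyadic chain.**  (hU) the one-octave UPPER step «fine below coarse» with summable defect and telescoping allowance,
for every base `L' ≥ L₀` (text (U₈) of the module doc); (hM) deep-window matching (body of `MatchedCouplingExists`).  Then for every depth
`lam ≤ min(lam₀, 1/2)`, every height `k`, base `L' ≥ L₀` and `L = 2^k·L'` at matched window couplings:
`λ₁(L')^{L'}·λ₀(L)^L ≤ exp((Φ(L) − Φ(L'))·Λ² + D(1/β' − 1/β))·λ₁(L)^L·λ₀(L')^{L'}`, `Φ(m) = (max(C,0)/κ)(1 − m^{−σ})`, `κ = 1 − 2^{−σ}`.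
Induction on `k`: the height-`k` matched coupling exists by (hM); the octave (hU) from height `k` to `k+1` costs `C·(2^kL')^{−σ}Λ²`, paid by
the potential (`step_budget`, `potential_half`), and its allowance `D(1/β_k − 1/β_{k+1})` telescopes; `k = 0` is the uniqueness of the matched
coupling at one size. [cite: LuscherWeiszWolff1991] [cite: Symanzik1983] -/
theorem upper_dyadic_chain {C σ D lam0 : ℝ} {L0 : ℕ} (hσ : 0 < σ)
    (hU : ∀ lam : ℝ, 0 < lam → lam ≤ lam0 →
      ∀ (L' : ℕ) [NeZero L'] (L : ℕ) [NeZero L], L0 ≤ L' → L = 2 * L' →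
        ∀ β β' : ℝ, InFemtoWindow lam β L → InFemtoWindow lam β' L' → luscherLambda β L = luscherLambda β' L' →
          secondValue su2Rep L' β' ^ L' * topValue su2Rep L β ^ L ≤
            Real.exp (C * luscherLambda β L ^ 2 / (L' : ℝ) ^ σ + D * (1 / β' - 1 / β)) *
              (secondValue su2Rep L β ^ L * topValue su2Rep L' β' ^ L'))
    (hM : ∀ lam : ℝ, 0 < lam → lam ≤ 1 / 2 → ∀ (L : ℕ) [NeZero L] (L' : ℕ) [NeZero L'] (β : ℝ),
      InFemtoWindow lam β L → ∃ β' : ℝ, InFemtoWindow lam β' L' ∧ luscherLambda β' L' = luscherLambda β L) :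
    ∀ lam : ℝ, 0 < lam → lam ≤ min lam0 (1 / 2) →
      ∀ (k : ℕ) (L' : ℕ) [NeZero L'] (L : ℕ) [NeZero L], L0 ≤ L' → L = 2 ^ k * L' →
        ∀ β β' : ℝ, InFemtoWindow lam β L → InFemtoWindow lam β' L' → luscherLambda β L = luscherLambda β' L' →
          secondValue su2Rep L' β' ^ L' * topValue su2Rep L β ^ L ≤
            Real.exp ((max C 0 / (1 - (1 / 2 : ℝ) ^ σ) * (1 - (((L : ℕ) : ℝ) ^ σ)⁻¹) -
                max C 0 / (1 - (1 / 2 : ℝ) ^ σ) * (1 - (((L' : ℕ) : ℝ) ^ σ)⁻¹)) * luscherLambda β L ^ 2 +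
                D * (1 / β' - 1 / β)) *
              (secondValue su2Rep L β ^ L * topValue su2Rep L' β' ^ L') := by
  intro lam hlam hle
  have hle0 : lam ≤ lam0 := hle.trans (min_le_left _ _)
  have hhalf : lam ≤ 1 / 2 := hle.trans (min_le_right _ _)
  set Cp : ℝ := max C 0 with hCp
  have hCp0 : 0 ≤ Cp := le_max_right _ _
  have hCle : C ≤ Cp := le_max_left _ _
  set q : ℝ := (1 / 2 : ℝ) ^ σ with hq_def
  have hq1 : q < 1 := Real.rpow_lt_one (by norm_num) (by norm_num) hσ
  set κ : ℝ := 1 - q with hκ_def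
  have hκ : 0 < κ := by rw [hκ_def]; linarith
  have hqκ : q = 1 - κ := by rw [hκ_def]; ring
  -- the potential
  let w : ℕ → ℝ := fun m => (((m : ℕ) : ℝ) ^ σ)⁻¹
  have hw0 : ∀ m : ℕ, 0 ≤ w m := fun m => inv_nonneg.mpr (Real.rpow_nonneg (Nat.cast_nonneg m) σ)
  show ∀ (k : ℕ) (L' : ℕ) [NeZero L'] (L : ℕ) [NeZero L], L0 ≤ L' → L = 2 ^ k * L' →
      ∀ β β' : ℝ, InFemtoWindow lam β L → InFemtoWindow lam β' L' → luscherLambda β L = luscherLambda β' L' →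
        secondValue su2Rep L' β' ^ L' * topValue su2Rep L β ^ L ≤
          Real.exp ((Cp / κ * (1 - w L) - Cp / κ * (1 - w L')) * luscherLambda β L ^ 2 + D * (1 / β' - 1 / β)) *
            (secondValue su2Rep L β ^ L * topValue su2Rep L' β' ^ L')
  intro k
  induction k with
  | zero =>
    intro L' _ L _ _hL0 hL β β' hW hW' hm
    rw [pow_zero, one_mul] at hL
    subst hL
    have hββ' : β = β' := WindowMatching.beta_eq_of_window hlam hW hW' hm
    subst hββ'
    simp only [sub_self, zero_mul, mul_zero, add_zero, Real.exp_zero, one_mul, le_refl]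
  | succ k ih =>
    intro L' _ L _ hL0 hL β β' hW hW' hm
    -- the middle lattice `M = 2^k L'`
    set M : ℕ := 2 ^ k * L' with hMdef
    have hL'pos : 0 < L' := Nat.pos_of_ne_zero (NeZero.ne L')
    have hMpos : 0 < M := Nat.mul_pos (pow_pos (by norm_num) k) hL'pos
    haveI : NeZero M := ⟨hMpos.ne'⟩
    have hLM : L = 2 * M := by rw [hL, hMdef, pow_succ]; ring
    have hL0M : L0 ≤ M := le_trans hL0 (by rw [hMdef]; exact Nat.le_mul_of_pos_left _ (pow_pos (by norm_num) k))
    -- matched coupling at height `k`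
    obtain ⟨βM, hWM, hΛM⟩ := hM lam hlam hhalf L M β hW
    have h1 := ih L' M hL0 rfl βM β' hWM hW' (hΛM.trans hm)
    have h2 := hU lam hlam hle0 M L hL0M hLM β βM hW hWM hΛM.symm
    -- combine
    have hTM : 0 < topValue su2Rep M βM ^ M := pow_pos (topValue_su2Rep_pos M βM) _
    have hT' : 0 ≤ topValue su2Rep L' β' ^ L' := pow_nonneg (topValue_su2Rep_pos L' β').le _
    have hTL : 0 ≤ topValue su2Rep L β ^ L := pow_nonneg (topValue_su2Rep_pos L β).le _
    have h3 := upper_chain_mul hTM hT' hTL h1 h2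
    have hb : 0 ≤ secondValue su2Rep L β ^ L * topValue su2Rep L' β' ^ L' :=
      mul_nonneg (pow_nonneg (secondValue_su2Rep_pos (by linarith [hW.1])).le _) hT'
    refine h3.trans (exp_mul_le_exp_mul ?_ hb)
    -- exponent bookkeeping: `Λ(βM, M) = Λ(β, L)`; the octave costs `C·w(M)·Λ²`, paid by the potential; the allowance telescopes
    rw [hΛM]
    set Λ : ℝ := luscherLambda β L with hΛ
    have hslack : C * Λ ^ 2 / ((M : ℕ) : ℝ) ^ σ = C * w M * Λ ^ 2 := by
      show C * Λ ^ 2 / ((M : ℕ) : ℝ) ^ σ = C * (((M : ℕ) : ℝ) ^ σ)⁻¹ * Λ ^ 2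
      ring
    rw [hslack]
    have hcontr : w L ≤ q * w M := by
      show (((L : ℕ) : ℝ) ^ σ)⁻¹ ≤ (1 / 2 : ℝ) ^ σ * (((M : ℕ) : ℝ) ^ σ)⁻¹
      rw [hLM]
      exact potential_half σ hMpos
    have hbudget := step_budget hCle hCp0 hκ hqκ (hw0 M) hcontr
    -- `C w(M) + Cp/κ (1 − w M) ≤ Cp/κ (1 − w L)`
    have hprod : (C * w M + Cp / κ * (1 - w M) - Cp / κ * (1 - w L')) * Λ ^ 2 ≤
        (Cp / κ * (1 - w L) - Cp / κ * (1 - w L')) * Λ ^ 2 :=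
      mul_le_mul_of_nonneg_right (by linarith) (sq_nonneg Λ)
    have hexp : (C * w M + Cp / κ * (1 - w M) - Cp / κ * (1 - w L')) * Λ ^ 2 =
        C * w M * Λ ^ 2 + (Cp / κ * (1 - w M) - Cp / κ * (1 - w L')) * Λ ^ 2 := by ring
    have hsplit : D * (1 / β' - 1 / βM) + D * (1 / βM - 1 / β) = D * (1 / β' - 1 / β) := by ring
    linarith [hprod, hexp, hsplit]

/-- ★★ **The body of `DyadicNestedUpper` from one-octave upper steps with decay.**  (hU), (hM) as in `upper_dyadic_chain` ⟹ there are
`C₁`, `lam₁ > 0` (namely `C₁ = max(C,0)/(1 − 2^{−σ}) + D`, `lam₁ = min(lam₀, 1/2)`, same threshold `L₀`) such that for every height `k`,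
base `L' ≥ L₀`, `L = 2^k L'` and matched window couplings, `λ₁(L')^{L'}·λ₀(L)^L ≤ e^{C₁Λ²}·λ₁(L)^L·λ₀(L')^{L'}` — the potential is bounded
by `max(C,0)/κ` and the allowance by `D/β' ≤ DΛ³/2 ≤ DΛ²` deep in the window (`inv_le_half_luscherLambda_cube`, `Λ ≤ 2·lam ≤ 1`).
[cite: LuscherWeiszWolff1991] [cite: Symanzik1983] -/
theorem dyadicNestedUpper_text_of_octaveUpper {C σ D lam0 : ℝ} {L0 : ℕ} (hσ : 0 < σ) (hlam0 : 0 < lam0) (hD : 0 ≤ D)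
    (hU : ∀ lam : ℝ, 0 < lam → lam ≤ lam0 →
      ∀ (L' : ℕ) [NeZero L'] (L : ℕ) [NeZero L], L0 ≤ L' → L = 2 * L' →
        ∀ β β' : ℝ, InFemtoWindow lam β L → InFemtoWindow lam β' L' → luscherLambda β L = luscherLambda β' L' →
          secondValue su2Rep L' β' ^ L' * topValue su2Rep L β ^ L ≤
            Real.exp (C * luscherLambda β L ^ 2 / (L' : ℝ) ^ σ + D * (1 / β' - 1 / β)) *
              (secondValue su2Rep L β ^ L * topValue su2Rep L' β' ^ L'))
    (hM : ∀ lam : ℝ, 0 < lam → lam ≤ 1 / 2 → ∀ (L : ℕ) [NeZero L] (L' : ℕ) [NeZero L'] (β : ℝ),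
      InFemtoWindow lam β L → ∃ β' : ℝ, InFemtoWindow lam β' L' ∧ luscherLambda β' L' = luscherLambda β L) :
    ∃ C₁ lam₁ : ℝ, 0 < lam₁ ∧ ∀ lam : ℝ, 0 < lam → lam ≤ lam₁ →
      ∀ (k : ℕ) (L' : ℕ) [NeZero L'] (L : ℕ) [NeZero L], L0 ≤ L' → L = 2 ^ k * L' →
        ∀ β β' : ℝ, InFemtoWindow lam β L → InFemtoWindow lam β' L' → luscherLambda β L = luscherLambda β' L' →
          secondValue su2Rep L' β' ^ L' * topValue su2Rep L β ^ L ≤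
            Real.exp (C₁ * luscherLambda β L ^ 2) * (secondValue su2Rep L β ^ L * topValue su2Rep L' β' ^ L') := by
  set Cp : ℝ := max C 0 with hCp
  have hCp0 : 0 ≤ Cp := le_max_right _ _
  set q : ℝ := (1 / 2 : ℝ) ^ σ with hq_def
  have hq0 : 0 ≤ q := Real.rpow_nonneg (by norm_num) σ
  have hq1 : q < 1 := Real.rpow_lt_one (by norm_num) (by norm_num) hσ
  have hκ : 0 < 1 - q := by linarith
  have hck : 0 ≤ Cp / (1 - q) := div_nonneg hCp0 hκ.le
  refine ⟨Cp / (1 - q) + D, min lam0 (1 / 2), lt_min hlam0 (by norm_num), ?_⟩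
  intro lam hlam hle k L' _ L _ hL0 hL β β' hW hW' hm
  have hhalf : lam ≤ 1 / 2 := hle.trans (min_le_right _ _)
  have h := upper_dyadic_chain hσ hU hM lam hlam hle k L' L hL0 hL β β' hW hW' hm
  have hb : 0 ≤ secondValue su2Rep L β ^ L * topValue su2Rep L' β' ^ L' :=
    mul_nonneg (pow_nonneg (secondValue_su2Rep_pos (by linarith [hW.1])).le _)
      (pow_nonneg (topValue_su2Rep_pos L' β').le _)
  refine h.trans (exp_mul_le_exp_mul ?_ hb)
  set Λ : ℝ := luscherLambda β L with hΛ
  -- potential bounded by `Cp/(1−q)`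
  have hwL : 0 ≤ (((L : ℕ) : ℝ) ^ σ)⁻¹ := inv_nonneg.mpr (Real.rpow_nonneg (Nat.cast_nonneg L) σ)
  have hwL' : (((L' : ℕ) : ℝ) ^ σ)⁻¹ ≤ 1 := potential_le_one hσ.le L'
  have hpot : Cp / (1 - q) * (1 - (((L : ℕ) : ℝ) ^ σ)⁻¹) - Cp / (1 - q) * (1 - (((L' : ℕ) : ℝ) ^ σ)⁻¹) ≤ Cp / (1 - q) := by
    have e1 : Cp / (1 - q) * (1 - (((L : ℕ) : ℝ) ^ σ)⁻¹) - Cp / (1 - q) * (1 - (((L' : ℕ) : ℝ) ^ σ)⁻¹) =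
        Cp / (1 - q) * ((((L' : ℕ) : ℝ) ^ σ)⁻¹ - (((L : ℕ) : ℝ) ^ σ)⁻¹) := by ring
    rw [e1]
    have : (((L' : ℕ) : ℝ) ^ σ)⁻¹ - (((L : ℕ) : ℝ) ^ σ)⁻¹ ≤ 1 := by linarith
    calc Cp / (1 - q) * ((((L' : ℕ) : ℝ) ^ σ)⁻¹ - (((L : ℕ) : ℝ) ^ σ)⁻¹) ≤ Cp / (1 - q) * 1 :=
          mul_le_mul_of_nonneg_left this hck
      _ = Cp / (1 - q) := mul_one _
  have hpot2 : (Cp / (1 - q) * (1 - (((L : ℕ) : ℝ) ^ σ)⁻¹) - Cp / (1 - q) * (1 - (((L' : ℕ) : ℝ) ^ σ)⁻¹)) * Λ ^ 2 ≤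
      Cp / (1 - q) * Λ ^ 2 := mul_le_mul_of_nonneg_right hpot (sq_nonneg Λ)
  -- allowance: `D(1/β' − 1/β) ≤ D/β' ≤ D Λ³/2 ≤ D Λ²`
  have hl' : 0 < luscherLambda β' L' := lt_of_lt_of_le hlam hW'.2.1
  have hΛ' : luscherLambda β' L' = Λ := hm.symm
  have hinv : 1 / β' ≤ Λ ^ 3 / 2 := by
    have := inv_le_half_luscherLambda_cube hlam hW'
    rwa [hΛ'] at this
  have hβpos : 0 < β := by linarith [hW.1]
  have hinvβ : 0 ≤ 1 / β := by positivity
  have hΛle1 : Λ ≤ 1 := by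
    have := hW.2.2; rw [← hΛ] at this; linarith
  have hΛ0 : 0 ≤ Λ := (lt_of_lt_of_le hlam (by rw [hΛ]; exact hW.2.1)).le
  have hcube : Λ ^ 3 / 2 ≤ Λ ^ 2 := by nlinarith [sq_nonneg Λ, mul_le_mul_of_nonneg_left hΛle1 (sq_nonneg Λ)]
  have hallow : D * (1 / β' - 1 / β) ≤ D * Λ ^ 2 := by
    have : 1 / β' - 1 / β ≤ Λ ^ 2 := by linarith
    exact mul_le_mul_of_nonneg_left this hD
  have htot : (Cp / (1 - q) * (1 - (((L : ℕ) : ℝ) ^ σ)⁻¹) - Cp / (1 - q) * (1 - (((L' : ℕ) : ℝ) ^ σ)⁻¹)) * Λ ^ 2 +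
      D * (1 / β' - 1 / β) ≤ (Cp / (1 - q) + D) * Λ ^ 2 := by nlinarith
  exact htot

end Summit.QuantumFields.YangMills.Theorems.FemtoTransferGap.CutoffLadder

end
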